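import Summits.QuantumFields.YangMills.Theorems.BalabanUVNodesN12BlockChains
import HarnessLib

/-!
# BalabanUVNodes ∕ N12 — NUMERICS OF THE (σ)_N CAPSTONE: the no-wrapping hypothesis `2ℓ_k + 1 + m·L^k < 2L^{m+K}` follows from a LEVEL GUARD `k + c ≤ m + K` (`4d + m + 3 < 2·L^c`), and the
# radius hypothesis `R(J) + 3 ≤ L^{J−1}·M₁` (`1 ≤ J ≤ k`) from ONE bound `(4d + m)·L² + 2d·L + 12 ≤ M₁` — `ℓ_n = Σ_{i≤n}(d(Lⁱ−1)∕2 + 1)`, `m = 3·d·(L−1)∕2 + 5`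
# (elementary arithmetic for `N12GaugeLetterLocAtRecord` ∕ `N12GaugeLetterLocOfClass`; [Balaban1988Convergent] (2.13): «M₁ a sufficiently large integer»)

Cell `pub-ymgap` (HUMAN RULINGS D-0062 ∕ D-0149), WIDTH SEAT `pub-ymgap-dag-n12-w3` g4 (node N12 = [B15]; key K1⁹ `stmt-QuantumFields-27364` (KEY MAP v2), `--kind proof --supports … --as
helper`; count-neutral).  THEOREMS ONLY (0 `def`, 0 `instance`, 0 `sorry`); elementary `ℕ` arithmetic, no analysis.

HONEST FRAMING.  Arithmetic only; which `M₁`, `k` the record carries is the knit's ∕ NODE 00's numerics; nothing of Bałaban's asserted; count-neutral; N12 NOT discharged; K1⁹ NOT closed; counts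
unmoved (typed 28∕28 · discharged 5∕27); one finite 𝕋⁴ programme at fixed ε — R4 closes the conditional rung `BalabanLadder.UV` only; the Yang–Mills mass gap (Clay) is NOT proved by any of this.
-/

noncomputable section

namespace Summit.QuantumFields.YangMills.BalabanUVNodes.N12GaugeLetterLocNumerics

open scoped BigOperators
open Literature.MathematicalPhysics.QuantumFieldTheory.Balaban1983to89
open T4Continuum

variable {P : Params}

/-! ## §1 The word budget `ℓ_n` is `≤ 2d·Lⁿ + n + 1` -/

/-- `Σ_{i≤n} Lⁱ ≤ 2·Lⁿ` for `L ≥ 2`. [folklore] -/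
theorem sum_pow_le_two_mul_pow {L : ℕ} (hL : 2 ≤ L) : ∀ n : ℕ, ∑ i ∈ Finset.range (n + 1), L ^ i ≤ 2 * L ^ n
  | 0 => by simp
  | n + 1 => by
      rw [Finset.sum_range_succ, pow_succ]
      have ih := sum_pow_le_two_mul_pow hL n
      have hLn : 0 < L ^ n := Nat.pow_pos (by omega)
      nlinarith

/-- **THE WORD BUDGET**: `ℓ_n = Σ_{i≤n}(d·((Lⁱ−1)∕2) + 1) ≤ 2d·Lⁿ + n + 1` (`L ≥ 2`). [cite: Balaban1987RG1, (0.1)–(0.3) pp.251–252 (bookkeeping)] -/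
theorem budget_le (n : ℕ) : ∑ i ∈ Finset.range (n + 1), (P.d * ((P.L ^ i - 1) / 2) + 1) ≤ 2 * P.d * P.L ^ n + (n + 1) := by
  have hL : 2 ≤ P.L := P.hL.2
  have h1 : ∑ i ∈ Finset.range (n + 1), (P.d * ((P.L ^ i - 1) / 2) + 1) ≤ ∑ i ∈ Finset.range (n + 1), (P.d * P.L ^ i + 1) :=
    Finset.sum_le_sum fun i _ => by
      have : (P.L ^ i - 1) / 2 ≤ P.L ^ i := by omega
      exact Nat.add_le_add_right (Nat.mul_le_mul_left _ this) 1
  refine h1.trans ?_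
  rw [Finset.sum_add_distrib, Finset.sum_const, Finset.card_range, smul_eq_mul, mul_one, ← Finset.mul_sum]
  have h2 := sum_pow_le_two_mul_pow hL n
  nlinarith

/-- `3n + 12 ≤ 12·Lⁿ` for `L ≥ 2`. [folklore] -/
theorem lin_le_twelve_mul_pow {L : ℕ} (hL : 2 ≤ L) : ∀ n : ℕ, 3 * n + 12 ≤ 12 * L ^ n
  | 0 => by simp
  | n + 1 => by
      have ih := lin_le_twelve_mul_pow hL n
      rw [pow_succ]
      have hLn : 1 ≤ L ^ n := Nat.one_le_pow n L (by omega)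
      nlinarith

/-- `2n + 3 ≤ 3·Lⁿ` for `L ≥ 2`. [folklore] -/
theorem lin_le_three_mul_pow {L : ℕ} (hL : 2 ≤ L) : ∀ n : ℕ, 2 * n + 3 ≤ 3 * L ^ n
  | 0 => by simp
  | n + 1 => by
      have ih := lin_le_three_mul_pow hL n
      rw [pow_succ]
      have hLn : 1 ≤ L ^ n := Nat.one_le_pow n L (by omega)
      nlinarith

/-! ## §2 The radius hypothesis from one bound on `M₁` -/

/-- ★★ **THE GRADED BOXES FIT THE COLLARS WHEN `M₁ ≥ (4d + m)·L² + 2d·L + 12`** (`m = 3·d·(L−1)∕2 + 5`): for every `1 ≤ J ≤ k`,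
`2ℓ_{J+1} + 1 + m·L^{min(J+1,k)} + ℓ_J + 3 ≤ L^{J−1}·M₁` — the hypothesis `hRad` of `N12GaugeLetterLocOfClass.exists_gaugeLetterLoc_atRecord_of_class`.
[cite: Balaban1988Convergent, (2.13) pp.256–257 («M₁ … sufficiently large»); Balaban1985RegularSpaces, (1.7) p.77] -/
theorem radius_le_of_M₁_ge {M₁ k : ℕ}
    (hM : (4 * P.d + (3 * (P.d * ((P.L - 1) / 2)) + 5)) * P.L ^ 2 + 2 * P.d * P.L + 12 ≤ M₁) :
    ∀ J, 1 ≤ J → J ≤ k →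
      (2 * ∑ i ∈ Finset.range (J + 1 + 1), (P.d * ((P.L ^ i - 1) / 2) + 1)) + 1 +
          (3 * (P.d * ((P.L - 1) / 2)) + 5) * P.L ^ min (J + 1) k +
        (∑ i ∈ Finset.range (J + 1), (P.d * ((P.L ^ i - 1) / 2) + 1)) + 3 ≤ P.L ^ (J - 1) * M₁ := by
  intro J hJ1 _
  have hL : 2 ≤ P.L := P.hL.2
  obtain ⟨n, rfl⟩ : ∃ n, J = n + 1 := ⟨J - 1, by omega⟩
  rw [Nat.add_sub_cancel]
  have hb1 := budget_le (P := P) (n + 1 + 1)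
  have hb2 := budget_le (P := P) (n + 1)
  have hmin : P.L ^ min (n + 1 + 1) k ≤ P.L ^ (n + 1 + 1) := Nat.pow_le_pow_right (by omega) (min_le_left _ _)
  have hlin := lin_le_twelve_mul_pow hL n
  have hLn : 1 ≤ P.L ^ n := Nat.one_le_pow n P.L (by omega)
  have e1 : P.L ^ (n + 1 + 1) = P.L ^ n * P.L ^ 2 := by ring
  have e2 : P.L ^ (n + 1) = P.L ^ n * P.L := by ring
  rw [e1] at hb1 hmin
  rw [e2] at hb2
  -- opaque atoms: the two sums, the `min`-power, the chain constant, `L^n`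
  generalize ∑ i ∈ Finset.range (n + 1 + 1 + 1), (P.d * ((P.L ^ i - 1) / 2) + 1) = S1 at hb1 ⊢
  generalize ∑ i ∈ Finset.range (n + 1 + 1), (P.d * ((P.L ^ i - 1) / 2) + 1) = S2 at hb2 ⊢
  generalize P.L ^ min (n + 1 + 1) k = Q at hmin ⊢
  generalize 3 * (P.d * ((P.L - 1) / 2)) + 5 = m at hM ⊢
  generalize P.L ^ n = X at hb1 hb2 hmin hlin hLn ⊢
  have p1 : m * Q ≤ m * (X * P.L ^ 2) := Nat.mul_le_mul_left m hmin
  have p2 : X * ((4 * P.d + m) * P.L ^ 2 + 2 * P.d * P.L + 12) ≤ X * M₁ := Nat.mul_le_mul_left X hM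
  nlinarith [p1, p2, hb1, hb2, hlin, hLn]

/-! ## §3 No wrapping from a level guard -/

/-- ★★ **NO WRAPPING FROM A LEVEL GUARD**: if `k + c ≤ m + K` and `4d + m + 3 < 2·L^c` (`m = 3·d·(L−1)∕2 + 5`), then `2ℓ_k + 1 + m·L^k < 2·L^{m+K} =` the number of fine sites per direction —
the hypothesis `hN` of the (σ)_N capstone. [cite: Balaban1987RG1, (0.1) p.251 (the torus `2L^{m+K}` sites per direction); Balaban1985Averaging, (7)–(9) pp.18–19] -/
theorem noWrap_of_levelGuard {k c : ℕ} (hkc : k + c ≤ P.m + P.K) (hc : 4 * P.d + (3 * (P.d * ((P.L - 1) / 2)) + 5) + 3 < 2 * P.L ^ c) :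
    2 * (∑ i ∈ Finset.range (k + 1), (P.d * ((P.L ^ i - 1) / 2) + 1)) + 1 + (3 * (P.d * ((P.L - 1) / 2)) + 5) * P.L ^ k < P.sitesPerDir 0 := by
  have hL : 2 ≤ P.L := P.hL.2
  set m : ℕ := 3 * (P.d * ((P.L - 1) / 2)) + 5 with hm
  have hb := budget_le (P := P) k
  have hlin := lin_le_three_mul_pow hL k
  have hLk : 1 ≤ P.L ^ k := Nat.one_le_pow k P.L (by omega)
  -- `2ℓ_k + 1 + m L^k ≤ (4d + m + 3)·L^k`
  have h1 : 2 * (∑ i ∈ Finset.range (k + 1), (P.d * ((P.L ^ i - 1) / 2) + 1)) + 1 + m * P.L ^ k ≤ (4 * P.d + m + 3) * P.L ^ k := by nlinarith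
  -- `(4d + m + 3)·L^k < 2·L^c·L^k ≤ 2·L^{m+K}`
  have h2 : (4 * P.d + m + 3) * P.L ^ k < 2 * P.L ^ c * P.L ^ k := Nat.mul_lt_mul_of_pos_right hc (by omega)
  have h3 : 2 * P.L ^ c * P.L ^ k ≤ 2 * P.L ^ (P.m + P.K) := by
    rw [mul_assoc, ← pow_add]
    exact Nat.mul_le_mul_left 2 (Nat.pow_le_pow_right (by omega) (by omega))
  have h4 : P.sitesPerDir 0 = 2 * P.L ^ (P.m + P.K) := by unfold Params.sitesPerDir; rw [Nat.sub_zero]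
  rw [h4]
  omega

end Summit.QuantumFields.YangMills.BalabanUVNodes.N12GaugeLetterLocNumerics

end
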